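import Summits.KontsevichZagierPeriods.KontsevichZagierPeriods.Theorems.SoloInformedScissorsCompact
import Summits.KontsevichZagierPeriods.KontsevichZagierPeriods.Theorems.SoloInformedChainSpan
import HarnessLib
import HarnessLib.Audit

/-!
# SoloInformed — the honest-chain reading of `KZ.Equivalent` (THEOREM CH, part 2)

Solo programme `solo-KontsevichZagierPeriods-informed`, session s262 (file 2).

The summit statement reads Kontsevich–Zagier's "pass from one formula to another using only rules
1), 2), 3)" as `ℤ`-SPAN membership `[r] − [r'] ∈ KZ.relations` (docstring of
`Literature.Periods.KZPeriodConjecture`: "a finite chain of moves, i.e. `[r] − [r']` lies in the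
subgroup (`ℤ`-span) generated by the move instances").  This file makes the "i.e." a theorem.

* `soloInformedKZSteps` — the four moves as HONEST REWRITE PAIRS of finite families of integral
  representations, with the literal hypotheses of `KZ.domainAddRel`, `KZ.integrandAddRel`,
  `KZ.changeOfVariablesRel`, `KZ.newtonLeibnizRel`: (1a) `{[σ₁∪σ₂, f]} ↔ {[σ₁, f], [σ₂, f]}`,
  (1b) `{[σ, f₁+f₂]} ↔ {[σ, f₁], [σ, f₂]}`, (2) `{[σ, f]} ↔ {[Φσ, g]}`, (3)
  `{[band, ∂ₜF]} ↔ {[τ, F(·,b) − F(·,a)]}`;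
* `soloInformed_relations_eq_pairSpan` — `KZ.relations` is the `ℤ`-span of these pairs;
* **THEOREM CH-2** (`soloInformed_equivalent_iff_exists_chain`) — `KZ.Equivalent r r'` iff for some
  auxiliary finite family `t` ("catalyst") the families `{r} + t` and `{r'} + t` are connected by a
  finite chain of honest rule applications, each replacing one side of a move instance present in
  the current family by its other side (`SoloInformedMoveChain`, Mathlib's `AddConGen.Rel`);
* `soloInformed_summit_iff_catalysedChains` — the summit in this form;
* the same for the scissors group `𝒮` (`soloInformed_scissorsRel_eq_pairSpan`,
  `soloInformed_sub_mem_scissorsRel_iff_exists_chain`) and hence the classical reading of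
  `STABLE-H3^cpt` (`soloInformed_summit_iff_stableH3Cpt_chains`): the period conjecture holds iff any
  two compact `ℚ`-semialgebraic sets of equal volume, after multiplying by a cube `[0,1]ᵏ` and
  adjoining a common auxiliary family of sets, are connected by honest cut / paste /
  volume-preserving-map steps ("equidecomposable with a common complement").

References: [Kontsevich–Zagier 2001, §1.2]; [Cueto–Viu-Sos 2022, §1]; this work
(`nl-elimination.md` COROLLARY NF.2, REMARK NF.4).
-/

noncomputable section

namespace Summit.KontsevichZagierPeriods.KontsevichZagierPeriods.Theorems

open Set MeasureTheory
open Literature.ModelTheory.ExponentialFields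
open Literature.NumberTheory.Transcendental Literature.NumberTheory.Transcendental.KZ

/-! ### The four moves as honest rewrite pairs -/

/-- **Move (1a) as a rewrite pair**: `{[σ₁ ∪ σ₂, f]} ↔ {[σ₁, f], [σ₂, f]}` under the literal
hypotheses of `KZ.domainAddRel`. [Kontsevich–Zagier 2001, §1.2, rule (1)] -/
def soloInformedStep1a : Set (Multiset (Σ n, IntegralRep n) × Multiset (Σ n, IntegralRep n)) :=
  {p | ∃ (n : ℕ) (r r₁ r₂ : IntegralRep n), r.domain = r₁.domain ∪ r₂.domain ∧
    volume (r₁.domain ∩ r₂.domain) = 0 ∧ EqOn r.integrand r₁.integrand r₁.domain ∧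
    EqOn r.integrand r₂.integrand r₂.domain ∧
    p = ({(⟨n, r⟩ : Σ n, IntegralRep n)}, {⟨n, r₁⟩, ⟨n, r₂⟩})}

/-- **Move (1b) as a rewrite pair**: `{[σ, f₁ + f₂]} ↔ {[σ, f₁], [σ, f₂]}` under the literal
hypotheses of `KZ.integrandAddRel`. [Kontsevich–Zagier 2001, §1.2, rule (1)] -/
def soloInformedStep1b : Set (Multiset (Σ n, IntegralRep n) × Multiset (Σ n, IntegralRep n)) :=
  {p | ∃ (n : ℕ) (r r₁ r₂ : IntegralRep n), r₁.domain = r.domain ∧ r₂.domain = r.domain ∧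
    EqOn r.integrand (r₁.integrand + r₂.integrand) r.domain ∧
    p = ({(⟨n, r⟩ : Σ n, IntegralRep n)}, {⟨n, r₁⟩, ⟨n, r₂⟩})}

/-- **Move (2) as a rewrite pair**: `{[σ, f]} ↔ {[Φ σ, g]}` under the literal hypotheses of
`KZ.changeOfVariablesRel`. [Kontsevich–Zagier 2001, §1.2, rule (2)] -/
def soloInformedStep2 : Set (Multiset (Σ n, IntegralRep n) × Multiset (Σ n, IntegralRep n)) :=
  {p | ∃ (n : ℕ) (r r' : IntegralRep n) (Φ : (Fin n → ℝ) → (Fin n → ℝ))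
      (Φ' : (Fin n → ℝ) → (Fin n → ℝ) →L[ℝ] (Fin n → ℝ)),
    IsSemialgebraicMapOn ℚ r.domain Φ ∧ (∀ x ∈ r.domain, HasFDerivWithinAt Φ (Φ' x) r.domain x) ∧
    InjOn Φ r.domain ∧ r'.domain = Φ '' r.domain ∧
    (∀ x ∈ r.domain, r.integrand x = r'.integrand (Φ x) * |(Φ' x).det|) ∧
    p = ({(⟨n, r⟩ : Σ n, IntegralRep n)}, {⟨n, r'⟩})}

/-- **Move (3) as a rewrite pair**: `{[band, ∂ₜF]} ↔ {[τ, F(·, b ·) − F(·, a ·)]}` under the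
literal hypotheses of `KZ.newtonLeibnizRel`. [Kontsevich–Zagier 2001, §1.2, rule (3)] -/
def soloInformedStep3 : Set (Multiset (Σ n, IntegralRep n) × Multiset (Σ n, IntegralRep n)) :=
  {p | ∃ (n : ℕ) (r : IntegralRep (n + 1)) (r' : IntegralRep n) (a b : (Fin n → ℝ) → ℝ)
      (F : (Fin (n + 1) → ℝ) → ℝ),
    IsSemialgebraicFunOn ℚ r.domain F ∧
    IsSemialgebraicFunOn ℚ r'.domain a ∧ IsSemialgebraicFunOn ℚ r'.domain b ∧
    (∀ x ∈ r'.domain, a x ≤ b x) ∧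
    r.domain = {z | (Fin.init z : Fin n → ℝ) ∈ r'.domain ∧ a (Fin.init z) ≤ z (Fin.last n) ∧
      z (Fin.last n) ≤ b (Fin.init z)} ∧
    (∀ x ∈ r'.domain, ContinuousOn (fun t : ℝ => F (Fin.snoc x t)) (Icc (a x) (b x))) ∧
    (∀ x ∈ r'.domain, ∀ t ∈ Ioo (a x) (b x),
      HasDerivAt (fun s : ℝ => F (Fin.snoc x s)) (r.integrand (Fin.snoc x t)) t) ∧
    (∀ x ∈ r'.domain, r'.integrand x = F (Fin.snoc x (b x)) - F (Fin.snoc x (a x))) ∧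
    p = ({(⟨n + 1, r⟩ : Σ n, IntegralRep n)}, {⟨n, r'⟩})}

/-- **The KZ calculus as a set of honest rewrite pairs** of finite families of integral
representations: the union of the four moves. [Kontsevich–Zagier 2001, §1.2] -/
def soloInformedKZSteps : Set (Multiset (Σ n, IntegralRep n) × Multiset (Σ n, IntegralRep n)) :=
  soloInformedStep1a ∪ soloInformedStep1b ∪ soloInformedStep2 ∪ soloInformedStep3

/-- `[r] − [r₁] − [r₂] = Σ{r} − Σ{r₁, r₂}`. [folklore] -/
theorem soloInformed_of_sub_of_sub_of_eq_msum {n m l : ℕ} (r : IntegralRep n) (r₁ : IntegralRep m)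
    (r₂ : IntegralRep l) :
    of r - of r₁ - of r₂ = soloInformedMsum {(⟨n, r⟩ : Σ n, IntegralRep n)} -
      soloInformedMsum {(⟨m, r₁⟩ : Σ n, IntegralRep n), ⟨l, r₂⟩} := by
  rw [soloInformedMsum_singleton, soloInformedMsum_pair, sub_sub]
  rfl

/-- `[r] − [r'] = Σ{r} − Σ{r'}`. [folklore] -/
theorem soloInformed_of_sub_of_eq_msum {n m : ℕ} (r : IntegralRep n) (r' : IntegralRep m) :
    of r - of r' = soloInformedMsum {(⟨n, r⟩ : Σ n, IntegralRep n)} -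
      soloInformedMsum {(⟨m, r'⟩ : Σ n, IntegralRep n)} := by
  rw [soloInformedMsum_singleton, soloInformedMsum_singleton]
  rfl

/-- **`KZ.relations` is the `ℤ`-span of the honest rewrite pairs.** [Kontsevich–Zagier 2001, §1.2] -/
theorem soloInformed_relations_eq_pairSpan :
    relations = soloInformedPairSpan soloInformedKZSteps := by
  apply le_antisymm
  · rw [relations, AddSubgroup.closure_le]
    rintro z (((h | h) | h) | h)
    · obtain ⟨n, r, r₁, r₂, h1, h2, h3, h4, rfl⟩ := h
      exact AddSubgroup.subset_closure ⟨_, Or.inl (Or.inl (Or.inl ⟨n, r, r₁, r₂, h1, h2, h3, h4,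
        rfl⟩)), soloInformed_of_sub_of_sub_of_eq_msum r r₁ r₂⟩
    · obtain ⟨n, r, r₁, r₂, h1, h2, h3, rfl⟩ := h
      exact AddSubgroup.subset_closure ⟨_, Or.inl (Or.inl (Or.inr ⟨n, r, r₁, r₂, h1, h2, h3,
        rfl⟩)), soloInformed_of_sub_of_sub_of_eq_msum r r₁ r₂⟩
    · obtain ⟨n, r, r', Φ, Φ', h1, h2, h3, h4, h5, rfl⟩ := h
      exact AddSubgroup.subset_closure ⟨_, Or.inl (Or.inr ⟨n, r, r', Φ, Φ', h1, h2, h3, h4, h5,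
        rfl⟩), soloInformed_of_sub_of_eq_msum r r'⟩
    · obtain ⟨n, r, r', a, b, F, h1, h2, h3, h4, h5, h6, h7, h8, rfl⟩ := h
      exact AddSubgroup.subset_closure ⟨_, Or.inr ⟨n, r, r', a, b, F, h1, h2, h3, h4, h5, h6, h7,
        h8, rfl⟩, soloInformed_of_sub_of_eq_msum r r'⟩
  · rw [soloInformedPairSpan, AddSubgroup.closure_le]
    rintro z ⟨p, (((h | h) | h) | h), rfl⟩
    · obtain ⟨n, r, r₁, r₂, h1, h2, h3, h4, rfl⟩ := h
      rw [SetLike.mem_coe, ← soloInformed_of_sub_of_sub_of_eq_msum]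
      exact domainAddRel_subset_relations ⟨n, r, r₁, r₂, h1, h2, h3, h4, rfl⟩
    · obtain ⟨n, r, r₁, r₂, h1, h2, h3, rfl⟩ := h
      rw [SetLike.mem_coe, ← soloInformed_of_sub_of_sub_of_eq_msum]
      exact integrandAddRel_subset_relations ⟨n, r, r₁, r₂, h1, h2, h3, rfl⟩
    · obtain ⟨n, r, r', Φ, Φ', h1, h2, h3, h4, h5, rfl⟩ := h
      rw [SetLike.mem_coe, ← soloInformed_of_sub_of_eq_msum]
      exact changeOfVariablesRel_subset_relations ⟨n, r, r', Φ, Φ', h1, h2, h3, h4, h5, rfl⟩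
    · obtain ⟨n, r, r', a, b, F, h1, h2, h3, h4, h5, h6, h7, h8, rfl⟩ := h
      rw [SetLike.mem_coe, ← soloInformed_of_sub_of_eq_msum]
      exact newtonLeibnizRel_subset_relations ⟨n, r, r', a, b, F, h1, h2, h3, h4, h5, h6, h7, h8, rfl⟩

/-! ### THEOREM CH-2: `Equivalent` = catalysed honest chains -/

/-- **THEOREM CH-2 (`KZ.Equivalent` is catalysed honest chain-connectedness).** `[r] − [r']` lies in
the `ℤ`-span `KZ.relations` iff, for some auxiliary finite family `t` of integral representations,
the families `{r} + t` and `{r'} + t` are connected by a finite chain of honest applications of the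
rules (1a), (1b), (2), (3), each replacing one side of a move instance present in the current family
by its other side. [Kontsevich–Zagier 2001, §1.2; this work, THEOREM CH] -/
theorem soloInformed_equivalent_iff_exists_chain {n m : ℕ} (r : IntegralRep n) (r' : IntegralRep m) :
    Equivalent r r' ↔ ∃ t : Multiset (Σ n, IntegralRep n),
      SoloInformedMoveChain soloInformedKZSteps ({(⟨n, r⟩ : Σ n, IntegralRep n)} + t)
        ({(⟨m, r'⟩ : Σ n, IntegralRep n)} + t) := by
  rw [Equivalent, soloInformed_relations_eq_pairSpan]
  exact soloInformed_of_sub_of_mem_pairSpan_iff soloInformedKZSteps ⟨n, r⟩ ⟨m, r'⟩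

/-- Honest chains (with or without catalyst) give `KZ.Equivalent`. [this work, THEOREM CH] -/
theorem soloInformed_equivalent_of_chain {n m : ℕ} {r : IntegralRep n} {r' : IntegralRep m}
    {t : Multiset (Σ n, IntegralRep n)}
    (h : SoloInformedMoveChain soloInformedKZSteps ({(⟨n, r⟩ : Σ n, IntegralRep n)} + t)
      ({(⟨m, r'⟩ : Σ n, IntegralRep n)} + t)) : Equivalent r r' :=
  (soloInformed_equivalent_iff_exists_chain r r').2 ⟨t, h⟩

/-- **The summit in honest-chain form.** The Kontsevich–Zagier period conjecture holds iff any two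
integral representations of KZ's rational shape with the same value become connected by a finite
chain of honest rule applications after adjoining a common auxiliary finite family of integral
representations. [Kontsevich–Zagier 2001, §1.2, Conjecture 1; this work, THEOREM CH] -/
theorem soloInformed_summit_iff_catalysedChains :
    KontsevichZagierPeriods ↔
      ∀ ⦃n m : ℕ⦄ (r : IntegralRep n) (r' : IntegralRep m), r.IsRational → r'.IsRational →
        r.value = r'.value → ∃ t : Multiset (Σ n, IntegralRep n),
          SoloInformedMoveChain soloInformedKZSteps ({(⟨n, r⟩ : Σ n, IntegralRep n)} + t)
            ({(⟨m, r'⟩ : Σ n, IntegralRep n)} + t) := by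
  rw [KontsevichZagierPeriods_iff]
  simp only [soloInformed_equivalent_iff_exists_chain]

/-! ### The scissors group `𝒮` as catalysed honest cut-and-paste -/

/-- **The scissors calculus as honest rewrite pairs**: scissors moves `{[σ₁ ∪ σ₂]} ↔ {[σ₁], [σ₂]}`
and volume-preserving maps `{[σ]} ↔ {[Φ σ]}` between volume representations (the generators
`soloInformedScissorsGen`, `soloInformedMapGen` of `𝒮`, as pairs of families). [this work, NF.2] -/
def soloInformedScissorsSteps :
    Set (Multiset (Σ n, IntegralRep n) × Multiset (Σ n, IntegralRep n)) :=
  {p | ∃ (n : ℕ) (r r₁ r₂ : IntegralRep n), SoloInformedIsVolRep r ∧ SoloInformedIsVolRep r₁ ∧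
    SoloInformedIsVolRep r₂ ∧ of r - of r₁ - of r₂ ∈ domainAddRel ∧
    p = ({(⟨n, r⟩ : Σ n, IntegralRep n)}, {⟨n, r₁⟩, ⟨n, r₂⟩})} ∪
  {p | ∃ (n m : ℕ) (r : IntegralRep n) (r' : IntegralRep m), n = m ∧ SoloInformedIsVolRep r ∧
    SoloInformedIsVolRep r' ∧ of r - of r' ∈ changeOfVariablesRel ∧
    p = ({(⟨n, r⟩ : Σ n, IntegralRep n)}, {⟨m, r'⟩})}

/-- **`𝒮` is the `ℤ`-span of the scissors rewrite pairs.** [this work, NF.2] -/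
theorem soloInformed_scissorsRel_eq_pairSpan :
    soloInformedScissorsRel = soloInformedPairSpan soloInformedScissorsSteps := by
  apply le_antisymm
  · rw [soloInformedScissorsRel, AddSubgroup.closure_le]
    rintro z (h | h)
    · obtain ⟨n, r, r₁, r₂, h1, h2, h3, h4, rfl⟩ := h
      exact AddSubgroup.subset_closure ⟨_, Or.inl ⟨n, r, r₁, r₂, h1, h2, h3, h4, rfl⟩,
        soloInformed_of_sub_of_sub_of_eq_msum r r₁ r₂⟩
    · obtain ⟨n, m, r, r', h1, h2, h3, h4, rfl⟩ := h
      exact AddSubgroup.subset_closure ⟨_, Or.inr ⟨n, m, r, r', h1, h2, h3, h4, rfl⟩,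
        soloInformed_of_sub_of_eq_msum r r'⟩
  · rw [soloInformedPairSpan, AddSubgroup.closure_le]
    rintro z ⟨p, (h | h), rfl⟩
    · obtain ⟨n, r, r₁, r₂, h1, h2, h3, h4, rfl⟩ := h
      rw [SetLike.mem_coe, ← soloInformed_of_sub_of_sub_of_eq_msum]
      exact AddSubgroup.subset_closure (Or.inl ⟨n, r, r₁, r₂, h1, h2, h3, h4, rfl⟩)
    · obtain ⟨n, m, r, r', h1, h2, h3, h4, rfl⟩ := h
      rw [SetLike.mem_coe, ← soloInformed_of_sub_of_eq_msum]
      exact AddSubgroup.subset_closure (Or.inr ⟨n, m, r, r', h1, h2, h3, h4, rfl⟩)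

/-- **Membership in `𝒮` is catalysed honest cut-and-paste**: `[r] − [r'] ∈ 𝒮` iff, after adjoining
a common auxiliary finite family `t` of volume representations ("a common complement"), the families
`{r} + t` and `{r'} + t` are connected by finitely many honest scissors / volume-preserving-map
steps. [this work, THEOREM CH + NF.2] -/
theorem soloInformed_sub_mem_scissorsRel_iff_exists_chain {n m : ℕ} (r : IntegralRep n)
    (r' : IntegralRep m) :
    of r - of r' ∈ soloInformedScissorsRel ↔ ∃ t : Multiset (Σ n, IntegralRep n),
      SoloInformedMoveChain soloInformedScissorsSteps ({(⟨n, r⟩ : Σ n, IntegralRep n)} + t)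
        ({(⟨m, r'⟩ : Σ n, IntegralRep n)} + t) := by
  rw [soloInformed_scissorsRel_eq_pairSpan]
  exact soloInformed_of_sub_of_mem_pairSpan_iff soloInformedScissorsSteps ⟨n, r⟩ ⟨m, r'⟩

/-- **The period conjecture as stable equidecomposability with a common complement.**
`KontsevichZagierPeriods` holds iff for any two COMPACT volume representations of the same dimension
and volume there are `k` and an auxiliary finite family `t` of volume representations such that
`{r × [0,1]ᵏ} + t` and `{r' × [0,1]ᵏ} + t` are connected by finitely many honest scissors /
volume-preserving-map steps. [this work, COROLLARY NF.2 + NF.4(3) + THEOREM CH] -/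
theorem soloInformed_summit_iff_stableH3Cpt_chains :
    KontsevichZagierPeriods ↔
      ∀ (n : ℕ) (r r' : IntegralRep n), SoloInformedIsVolRep r → SoloInformedIsVolRep r' →
        IsCompact r.domain → IsCompact r'.domain → r.value = r'.value →
          ∃ (k : ℕ) (t : Multiset (Σ n, IntegralRep n)),
            SoloInformedMoveChain soloInformedScissorsSteps
              ({(⟨n + k, soloInformedFlatIter r k⟩ : Σ n, IntegralRep n)} + t)
              ({(⟨n + k, soloInformedFlatIter r' k⟩ : Σ n, IntegralRep n)} + t) := by
  rw [soloInformed_summit_iff_stableH3Cpt]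
  simp only [SoloInformedStableH3Cpt, soloInformed_sub_mem_scissorsRel_iff_exists_chain]

end Summit.KontsevichZagierPeriods.KontsevichZagierPeriods.Theorems

end
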